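import Literature.Analysis.FluidPDE.AgeDecouplingGridPairing
import Literature.Analysis.FluidPDE.AgeDecouplingGridSlack
import Literature.Analysis.FluidPDE.AgeDecouplingGridSums
import Literature.Analysis.FluidPDE.AgeDecouplingInequality
import Literature.Analysis.FluidPDE.LongTimeAverageSlidingWindow
import HarnessLib

/-!
# Grid age decoupling, VII: the Cesàro bound on the mean dissipation of a sourced scalar

Analysis/FluidPDE proof-support file (everything proved). The per-solution conclusion of the GRID
age-decoupling argument: for `κ > 0`, a GLOBAL weak solution `θ` of `∂ₜθ + u·∇θ = κΔθ + h` with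
`L²` datum and smooth mean-zero source `h` over a drift with `∫₀ᵀ‖∇u‖_{L²} < ∞`, `t ↦ ∫‖u(t)‖²`
locally integrable with bounded running means `⟨‖u‖²⟩ ≤ E`, variance `⟨‖θ‖²⟩ ≤ R`, a mesh
`0 < δ ≤ S/2`, and a countable family of bounded weak releases `ϑ_n` of `h` at the grid times
`δ(n+1)` (`∫ϑ_n² ≤ ∫h²` a.e.), the mean dissipation obeys (`longTimeAvgSup_dissipationRate_le_grid`)

  `⟨κ‖∇θ‖²⟩ ≤ (√(S D̄) + √(R/(2S) + δ (K_a + κ₁ K_b)/S + 2 S D̄))²`,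

`D̄ = limsup_N N⁻¹ ∑_{n<N} (eScalarDissipation κ ϑ_n 0 S).toReal` the discrete Cesàro mean of the
window-`S` dissipations of the releases, `κ ≤ κ₁`, and `K_a`, `K_b` explicit polynomials in
`S, R, E, ∫h², sup‖∇h‖, sup|Δh|`. Proof: the real-variable core
`AgeDecoupling.longTimeAvgSup_le_of_window` fed with (H1) (`SourcedScalarBudget`), (H2) (taken as the
hypothesis `hW` for a.e. `t > S + δ` — it is `AgeDecouplingGridWindow.ae_window_ineq` — and patched on
`(S, S+δ]` by `|∫_{t-S}^t P|`), (H3), the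
grid step function of `√D_n` as `w` (`AgeDecouplingGridSums.longTimeAvgSup_gridFun_le`) and the
`O(δ)` running means of the slack (`AgeDecouplingGridSlack`). No single printed source (Duhamel +
Cauchy–Schwarz bookkeeping in the spirit of Doering–Foias 2002 §2 and DEIJ 2022 (1.2)–(1.3)).
[folklore]
-/

noncomputable section

open _root_.MeasureTheory _root_.Set _root_.Filter _root_.Function _root_.TopologicalSpace
open scoped ENNReal NNReal InnerProductSpace _root_.Topology

namespace Literature.Analysis.FluidPDE

/-! ## Running means of the patched slack -/

namespace AgeDecoupling

/-- **The running means of the patched slack are eventually `O(δ)`**: with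
`SL = ∫_{t-S}^{t-S+δ} f₁ + ∫_{t-δ}^t f₁ + δ∫_{t-S}^t f₂ + c₁ + c₂∫_{t-S}^t f₃` (`f_i ≥ 0` locally integrable with
running means eventually `≤ M_i`), `g ≥ 0` integrable on `(S, S+δ]`, `0 < δ ≤ S`, `c₁, c₂ ≥ 0`:
eventually `⟨1_{(S,S+δ]} g + 1_{(S,∞)} SL⟩_T ≤ δ(2M₁ + S M₂ + 1) + c₁ + c₂ S M₃`. [folklore] -/
theorem eventually_timeMean_patchedSlack_le {g f₁ f₂ f₃ : ℝ → ℝ} {δ S c₁ c₂ M₁ M₂ M₃ : ℝ}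
    (h1 : ∀ T, IntegrableOn f₁ (Ioc 0 T)) (h2 : ∀ T, IntegrableOn f₂ (Ioc 0 T)) (h3 : ∀ T, IntegrableOn f₃ (Ioc 0 T))
    (h10 : ∀ t, 0 ≤ f₁ t) (h20 : ∀ t, 0 ≤ f₂ t) (h30 : ∀ t, 0 ≤ f₃ t) (hδ : 0 < δ) (hδS : δ ≤ S)
    (hc₁ : 0 ≤ c₁) (hc₂ : 0 ≤ c₂) (hg0 : ∀ t, 0 ≤ g t) (hgi : IntegrableOn g (Ioc S (S + δ)))
    (hM1 : ∀ᶠ T in atTop, timeMean f₁ T ≤ M₁) (hM2 : ∀ᶠ T in atTop, timeMean f₂ T ≤ M₂)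
    (hM3 : ∀ᶠ T in atTop, timeMean f₃ T ≤ M₃) :
    ∀ᶠ T in atTop, timeMean (fun t => (Ioc S (S + δ)).indicator g t + (Ioi S).indicator (fun t =>
        ((∫ s in (t - S)..(t - S + δ), f₁ s) + ∫ s in (t - δ)..t, f₁ s) + δ * (∫ s in (t - S)..t, f₂ s) + c₁ +
          c₂ * ∫ s in (t - S)..t, f₃ s) t) T ≤
      δ * (2 * M₁ + S * M₂ + 1) + c₁ + c₂ * (S * M₃) := by
  have hS : 0 ≤ S := hδ.le.trans hδS
  set Cb : ℝ := ∫ t in Ioc S (S + δ), g t with hCb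
  have hCb0 : 0 ≤ Cb := setIntegral_nonneg measurableSet_Ioc fun t _ => hg0 t
  have hCbT : ∀ᶠ T : ℝ in atTop, Cb / T ≤ δ := by
    have h0 : Tendsto (fun T : ℝ => Cb / T) atTop (𝓝 0) := tendsto_const_nhds.div_atTop tendsto_id
    exact (h0.eventually (ge_mem_nhds hδ)).mono fun T hT => hT
  have hM20 : ∀ᶠ T in atTop, 0 ≤ timeMean f₂ T := (eventually_ge_atTop (0 : ℝ)).mono fun T hT => timeMean_nonneg h20 hT
  filter_upwards [hM1, hM2, hM3, hCbT, eventually_ge_atTop (S + δ), eventually_gt_atTop (0 : ℝ)] with T hT1 hT2 hT3 hT4 hT5 hT0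
  have hSL := integral_slack_le (c₁ := c₁) h1 h2 h3 h10 h20 h30 hδ.le hδS hc₂ (by linarith : S ≤ T)
  have hcont : ∀ T, ContinuousOn (fun t => ((∫ s in (t - S)..(t - S + δ), f₁ s) + ∫ s in (t - δ)..t, f₁ s) +
      δ * (∫ s in (t - S)..t, f₂ s) + c₁ + c₂ * ∫ s in (t - S)..t, f₃ s) (Icc S T) := fun T =>
    continuousOn_slack h1 h2 h3 hδ.le hδS T
  have heq := setIntegral_patchedSlack_eq hS hδ.le hgi hcont hT5
  -- running means of the budgets
  have em : ∀ f : ℝ → ℝ, ∫ s in (0 : ℝ)..T, f s = T * timeMean f T := fun f => by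
    rw [timeMean, ← mul_assoc, mul_inv_cancel₀ hT0.ne', one_mul]
  rw [em f₁, em f₂, em f₃] at hSL
  have e2 : (δ * (2 * (T * timeMean f₁ T) + S * (T * timeMean f₂ T)) + c₁ * (T - S) + c₂ * (S * (T * timeMean f₃ T))) / T =
      δ * (2 * timeMean f₁ T + S * timeMean f₂ T) + c₁ * (T - S) / T + c₂ * (S * timeMean f₃ T) := by
    field_simp
  have hSL' := div_le_div_of_nonneg_right hSL hT0.le
  rw [e2] at hSL'
  have e1 : ((∫ t in Ioc S (S + δ), g t) + ∫ t in S..T, ((∫ s in (t - S)..(t - S + δ), f₁ s) + ∫ s in (t - δ)..t, f₁ s) +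
      δ * (∫ s in (t - S)..t, f₂ s) + c₁ + c₂ * ∫ s in (t - S)..t, f₃ s) / T =
      Cb / T + (∫ t in S..T, ((∫ s in (t - S)..(t - S + δ), f₁ s) + ∫ s in (t - δ)..t, f₁ s) +
        δ * (∫ s in (t - S)..t, f₂ s) + c₁ + c₂ * ∫ s in (t - S)..t, f₃ s) / T := by rw [hCb, add_div]
  unfold timeMean
  rw [intervalIntegral.integral_of_le hT0.le, heq, inv_mul_eq_div, e1]
  have e3 : c₁ * (T - S) / T ≤ c₁ := by
    rw [div_le_iff₀ hT0]; nlinarith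
  have e4 : δ * (2 * timeMean f₁ T + S * timeMean f₂ T) ≤ δ * (2 * M₁ + S * M₂) := by
    refine mul_le_mul_of_nonneg_left ?_ hδ.le
    nlinarith [mul_le_mul_of_nonneg_left hT2 hS]
  have e5 : c₂ * (S * timeMean f₃ T) ≤ c₂ * (S * M₃) := mul_le_mul_of_nonneg_left (mul_le_mul_of_nonneg_left hT3 hS) hc₂
  linarith

end AgeDecoupling

namespace Torus

variable {d : Type*} [Fintype d]

section Estimate

variable {κ δ S B Cg Cl : ℝ} {u : ℝ → UnitAddTorus d → EuclideanSpace ℝ d} {h θ₀ : UnitAddTorus d → ℝ}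
  {θ : ℝ → UnitAddTorus d → ℝ} {ϑ : ℕ → ℝ → UnitAddTorus d → ℝ}

/-! ## (H2) with the patched slack -/

/-- **(H2) for a.e. `t > S` with the patched slack**: the grid window inequality for a.e. `t > S + δ`
(hypothesis `hW`, supplied by `AgeDecouplingGridWindow.ae_window_ineq`), and the trivial inequality
`∫_{t-S}^t P ≤ |∫_{t-S}^t P|` on `(S, S+δ]`. [folklore] -/
theorem ae_window_ineq_patched (hκ : 0 < κ)
    (hCg : ∀ x, ‖FunctionSpaces.Torus.gradient h x‖ ≤ Cg) (hCl : ∀ x, |FunctionSpaces.Torus.laplacian h x| ≤ Cl)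
    (hδ : 0 < δ) (hδS : 2 * δ ≤ S)
    (hW : ∀ᵐ t ∂((volume : Measure ℝ).restrict (Ioi (S + δ))),
      ∫ s in (t - S)..t, ((∫ y, θ₀ y * h y) + ∫ τ in Ioc 0 s, ((∫ y, θ τ y *
          (⟪u τ y, FunctionSpaces.Torus.gradient h y⟫_ℝ + κ * FunctionSpaces.Torus.laplacian h y)) + ∫ y, h y * h y)) ≤
        scalarL2Sq (θ t) / 2 +
        2 * Real.sqrt (∫ s in (t - S)..t, κ * (eScalarGradNormSq (θ s)).toReal) *
          (∫ s in (t - S)..t, if 0 < s then Real.sqrt (eScalarDissipation κ (ϑ (⌈s / δ⌉₊ - 1)) 0 S).toReal else 0) +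
        (∫ s in (t - S)..t, if 0 < s then Real.sqrt (eScalarDissipation κ (ϑ (⌈s / δ⌉₊ - 1)) 0 S).toReal else 0) ^ 2 +
        (((∫ s in (t - S)..(t - S + δ), (1 + (∫ y, h y ^ 2) * scalarL2Sq (θ s)) / 2) +
            ∫ s in (t - δ)..t, (1 + (∫ y, h y ^ 2) * scalarL2Sq (θ s)) / 2) +
          δ * (∫ s in (t - S)..t, (Cg * (scalarL2Sq (θ s) + ∫ y, ‖u s y‖ ^ 2) / 2 +
            κ * Cl * (1 + scalarL2Sq (θ s)) / 2 + ∫ y, h y ^ 2)) +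
          (3 / 2) * δ * S * (∫ y, h y ^ 2) +
          2 * δ * S * ((Cg * (∫ y, h y ^ 2) / 2 + κ * Cl * (1 + ∫ y, h y ^ 2) / 2) * S +
            Cg / 2 * ∫ s in (t - S)..t, ∫ y, ‖u s y‖ ^ 2))) :
    ∀ᵐ t ∂((volume : Measure ℝ).restrict (Ioi S)),
      ∫ s in (t - S)..t, ((∫ y, θ₀ y * h y) + ∫ τ in Ioc 0 s, ((∫ y, θ τ y *
          (⟪u τ y, FunctionSpaces.Torus.gradient h y⟫_ℝ + κ * FunctionSpaces.Torus.laplacian h y)) + ∫ y, h y * h y)) ≤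
        scalarL2Sq (θ t) / 2 +
        2 * Real.sqrt (∫ s in (t - S)..t, κ * (eScalarGradNormSq (θ s)).toReal) *
          (∫ s in (t - S)..t, if 0 < s then Real.sqrt (eScalarDissipation κ (ϑ (⌈s / δ⌉₊ - 1)) 0 S).toReal else 0) +
        (∫ s in (t - S)..t, if 0 < s then Real.sqrt (eScalarDissipation κ (ϑ (⌈s / δ⌉₊ - 1)) 0 S).toReal else 0) ^ 2 +
        ((Ioc S (S + δ)).indicator (fun t => |∫ s in (t - S)..t, ((∫ y, θ₀ y * h y) + ∫ τ in Ioc 0 s, ((∫ y, θ τ y *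
            (⟪u τ y, FunctionSpaces.Torus.gradient h y⟫_ℝ + κ * FunctionSpaces.Torus.laplacian h y)) + ∫ y, h y * h y))|) t +
          (Ioi S).indicator (fun t =>
            ((∫ s in (t - S)..(t - S + δ), (1 + (∫ y, h y ^ 2) * scalarL2Sq (θ s)) / 2) +
                ∫ s in (t - δ)..t, (1 + (∫ y, h y ^ 2) * scalarL2Sq (θ s)) / 2) +
              δ * (∫ s in (t - S)..t, (Cg * (scalarL2Sq (θ s) + ∫ y, ‖u s y‖ ^ 2) / 2 +
                κ * Cl * (1 + scalarL2Sq (θ s)) / 2 + ∫ y, h y ^ 2)) +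
              (3 / 2 * δ * S * (∫ y, h y ^ 2) + 2 * δ * S * ((Cg * (∫ y, h y ^ 2) / 2 + κ * Cl * (1 + ∫ y, h y ^ 2) / 2) * S)) +
              δ * S * Cg * ∫ s in (t - S)..t, ∫ y, ‖u s y‖ ^ 2) t) := by
  have hS : 0 < S := by linarith
  have hCg0 : 0 ≤ Cg := (norm_nonneg _).trans (hCg 0)
  have hCl0 : 0 ≤ Cl := (abs_nonneg _).trans (hCl 0)
  have hH20 : 0 ≤ ∫ y, h y ^ 2 := integral_nonneg fun _ => sq_nonneg _
  have hunion : Ioi S = Ioc S (S + δ) ∪ Ioi (S + δ) := (Ioc_union_Ioi_eq_Ioi (by linarith)).symm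
  -- the slack is nonnegative
  have hF0 : ∀ s, 0 ≤ (1 + (∫ y, h y ^ 2) * scalarL2Sq (θ s)) / 2 := fun s =>
    div_nonneg (add_nonneg zero_le_one (mul_nonneg hH20 (integral_nonneg fun _ => sq_nonneg _))) zero_le_two
  have hK0 : ∀ s, 0 ≤ Cg * (scalarL2Sq (θ s) + ∫ y, ‖u s y‖ ^ 2) / 2 + κ * Cl * (1 + scalarL2Sq (θ s)) / 2 + ∫ y, h y ^ 2 :=
    fun s => by
    have h1 : 0 ≤ scalarL2Sq (θ s) := integral_nonneg fun _ => sq_nonneg _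
    have h2 : 0 ≤ ∫ y, ‖u s y‖ ^ 2 := integral_nonneg fun _ => sq_nonneg _
    have h3 : 0 ≤ κ * Cl := mul_nonneg hκ.le hCl0
    exact add_nonneg (add_nonneg (div_nonneg (mul_nonneg hCg0 (add_nonneg h1 h2)) zero_le_two)
      (div_nonneg (mul_nonneg h3 (by linarith)) zero_le_two)) hH20
  have hE0 : ∀ s, 0 ≤ ∫ y, ‖u s y‖ ^ 2 := fun s => integral_nonneg fun _ => sq_nonneg _
  have hc₁ : 0 ≤ 3 / 2 * δ * S * (∫ y, h y ^ 2) + 2 * δ * S * ((Cg * (∫ y, h y ^ 2) / 2 + κ * Cl * (1 + ∫ y, h y ^ 2) / 2) * S) := by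
    have h3 : 0 ≤ κ * Cl := mul_nonneg hκ.le hCl0
    have h4 : 0 ≤ Cg * (∫ y, h y ^ 2) / 2 + κ * Cl * (1 + ∫ y, h y ^ 2) / 2 :=
      add_nonneg (div_nonneg (mul_nonneg hCg0 hH20) zero_le_two) (div_nonneg (mul_nonneg h3 (by linarith)) zero_le_two)
    have := hδ.le; have := hS.le
    positivity
  have hc₂ : 0 ≤ δ * S * Cg := by have := hδ.le; have := hS.le; positivity
  have hSL0 := AgeDecoupling.slack_nonneg hF0 hK0 hE0 hδ.le hS.le hc₁ hc₂
  have hw0 : ∀ t, S < t → 0 ≤ ∫ s in (t - S)..t, (if 0 < s then Real.sqrt (eScalarDissipation κ (ϑ (⌈s / δ⌉₊ - 1)) 0 S).toReal else 0) :=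
    fun t _ => intervalIntegral.integral_nonneg (by linarith) fun s _ => by
      split_ifs
      · exact Real.sqrt_nonneg _
      · exact le_rfl
  rw [show ((volume : Measure ℝ).restrict (Ioi S)) = (volume : Measure ℝ).restrict (Ioc S (S + δ) ∪ Ioi (S + δ)) by
    rw [← hunion], ae_restrict_union_iff]
  constructor
  · filter_upwards [ae_restrict_mem measurableSet_Ioc] with t ht
    rw [indicator_of_mem ht, indicator_of_mem (show t ∈ Ioi S from ht.1)]
    have h1 : 0 ≤ scalarL2Sq (θ t) := integral_nonneg fun _ => sq_nonneg _
    have h2 := mul_nonneg (mul_nonneg zero_le_two (Real.sqrt_nonneg (∫ s in (t - S)..t, κ * (eScalarGradNormSq (θ s)).toReal)))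
      (hw0 t ht.1)
    have h3 := sq_nonneg (∫ s in (t - S)..t, (if 0 < s then Real.sqrt (eScalarDissipation κ (ϑ (⌈s / δ⌉₊ - 1)) 0 S).toReal else 0))
    have h4 := hSL0 t
    have h5 := le_abs_self (∫ s in (t - S)..t, ((∫ y, θ₀ y * h y) + ∫ τ in Ioc 0 s, ((∫ y, θ τ y *
          (⟪u τ y, FunctionSpaces.Torus.gradient h y⟫_ℝ + κ * FunctionSpaces.Torus.laplacian h y)) + ∫ y, h y * h y)))
    linarith
  · filter_upwards [hW, ae_restrict_mem measurableSet_Ioi] with t ht hmem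
    have hmem' : S + δ < t := hmem
    have hnot : t ∉ Ioc S (S + δ) := fun h' => not_lt.2 h'.2 hmem'
    rw [indicator_of_notMem hnot, indicator_of_mem (show t ∈ Ioi S from lt_trans (by linarith) hmem'), zero_add]
    refine ht.trans (le_of_eq ?_)
    ring

/-! ## The Cesàro bound -/

set_option maxHeartbeats 400000 in
/-- **The grid age-decoupling bound on the mean dissipation of a sourced scalar** (see the module
docstring for the statement and the constants). [folklore] -/
theorem longTimeAvgSup_dissipationRate_le_grid (hκ : 0 < κ) {κ₁ : ℝ} (hκ₁ : κ ≤ κ₁)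
    (hθ : IsWeakScalarTransportForced κ u (fun _ => h) θ₀ θ) (hθ₀ : MemLp θ₀ 2 volume)
    (hh : FunctionSpaces.Torus.IsSmooth h) (hh0 : FunctionSpaces.Torus.HasZeroMean h)
    (hCg : ∀ x, ‖FunctionSpaces.Torus.gradient h x‖ ≤ Cg) (hCl : ∀ x, |FunctionSpaces.Torus.laplacian h x| ≤ Cl)
    (hG : ∀ T, 0 < T → ∫⁻ t in Ioo 0 T, FunctionSpaces.Torus.eGradNormSq (u t) ^ (1 / 2 : ℝ) < ⊤)
    (hEu : ∀ T, 0 < T → IntegrableOn (fun s => ∫ y, ‖u s y‖ ^ 2) (Ioc 0 T) volume)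
    (hEb : IsBoundedUnder (· ≤ ·) atTop (timeMean fun s => ∫ y, ‖u s y‖ ^ 2))
    {R E : ℝ} (hR : longTimeAvgSup (fun t => scalarL2Sq (θ t)) ≤ R) (hE : longTimeAvgSup (fun s => ∫ y, ‖u s y‖ ^ 2) ≤ E)
    (hδ : 0 < δ) (hδS : 2 * δ ≤ S)
    (hrel : ∀ n : ℕ, IsWeakScalarTransportOn (S + 1) κ (fun τ => u (δ * (n + 1) + τ)) h (ϑ n))
    (hW : ∀ᵐ t ∂((volume : Measure ℝ).restrict (Ioi (S + δ))),
      ∫ s in (t - S)..t, ((∫ y, θ₀ y * h y) + ∫ τ in Ioc 0 s, ((∫ y, θ τ y *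
          (⟪u τ y, FunctionSpaces.Torus.gradient h y⟫_ℝ + κ * FunctionSpaces.Torus.laplacian h y)) + ∫ y, h y * h y)) ≤
        scalarL2Sq (θ t) / 2 +
        2 * Real.sqrt (∫ s in (t - S)..t, κ * (eScalarGradNormSq (θ s)).toReal) *
          (∫ s in (t - S)..t, if 0 < s then Real.sqrt (eScalarDissipation κ (ϑ (⌈s / δ⌉₊ - 1)) 0 S).toReal else 0) +
        (∫ s in (t - S)..t, if 0 < s then Real.sqrt (eScalarDissipation κ (ϑ (⌈s / δ⌉₊ - 1)) 0 S).toReal else 0) ^ 2 +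
        (((∫ s in (t - S)..(t - S + δ), (1 + (∫ y, h y ^ 2) * scalarL2Sq (θ s)) / 2) +
            ∫ s in (t - δ)..t, (1 + (∫ y, h y ^ 2) * scalarL2Sq (θ s)) / 2) +
          δ * (∫ s in (t - S)..t, (Cg * (scalarL2Sq (θ s) + ∫ y, ‖u s y‖ ^ 2) / 2 +
            κ * Cl * (1 + scalarL2Sq (θ s)) / 2 + ∫ y, h y ^ 2)) +
          (3 / 2) * δ * S * (∫ y, h y ^ 2) +
          2 * δ * S * ((Cg * (∫ y, h y ^ 2) / 2 + κ * Cl * (1 + ∫ y, h y ^ 2) / 2) * S +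
            Cg / 2 * ∫ s in (t - S)..t, ∫ y, ‖u s y‖ ^ 2))) :
    longTimeAvgSup (fun t => κ * (eScalarGradNormSq (θ t)).toReal) ≤
      (Real.sqrt (S * limsup (fun N : ℕ => (N : ℝ)⁻¹ *
          ∑ n ∈ Finset.range N, (eScalarDissipation κ (ϑ n) 0 S).toReal) atTop) +
        Real.sqrt (R / (2 * S) +
          δ * ((2 + (∫ y, h y ^ 2) * (R + 1) + S * (Cg / 2 * (R + 1) + Cg / 2 * (E + 1) + ∫ y, h y ^ 2) +
              3 / 2 * S * (∫ y, h y ^ 2) + S ^ 2 * Cg * (∫ y, h y ^ 2) + S ^ 2 * Cg * (E + 1)) +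
            κ₁ * (S * (Cl / 2 * (R + 1) + Cl / 2) + S ^ 2 * Cl * (1 + ∫ y, h y ^ 2))) / S +
          2 * S * limsup (fun N : ℕ => (N : ℝ)⁻¹ *
            ∑ n ∈ Finset.range N, (eScalarDissipation κ (ϑ n) 0 S).toReal) atTop)) ^ 2 := by
  have hS : 0 < S := by linarith
  have hCg0 : 0 ≤ Cg := (norm_nonneg _).trans (hCg 0)
  have hCl0 : 0 ≤ Cl := (abs_nonneg _).trans (hCl 0)
  set H₂ : ℝ := ∫ y, h y ^ 2 with hH₂
  have hH20 : 0 ≤ H₂ := integral_nonneg fun _ => sq_nonneg _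
  -- the five functions
  set P : ℝ → ℝ := fun s => (∫ y, θ₀ y * h y) + ∫ τ in Ioc 0 s, ((∫ y, θ τ y *
    (⟪u τ y, FunctionSpaces.Torus.gradient h y⟫_ℝ + κ * FunctionSpaces.Torus.laplacian h y)) + ∫ y, h y * h y) with hP
  set e : ℝ → ℝ := fun s => scalarL2Sq (θ s) with he
  set q : ℝ → ℝ := fun s => κ * (eScalarGradNormSq (θ s)).toReal with hq
  set Eu : ℝ → ℝ := fun s => ∫ y, ‖u s y‖ ^ 2 with hEu_def
  set c : ℕ → ℝ := fun n => (eScalarDissipation κ (ϑ n) 0 S).toReal with hc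
  set w : ℝ → ℝ := fun s => if 0 < s then Real.sqrt (c (⌈s / δ⌉₊ - 1)) else 0 with hw
  set F : ℝ → ℝ := fun s => (1 + H₂ * e s) / 2 with hF
  set K : ℝ → ℝ := fun s => Cg * (e s + Eu s) / 2 + κ * Cl * (1 + e s) / 2 + H₂ with hK
  set c₁ : ℝ := 3 / 2 * δ * S * H₂ + 2 * δ * S * ((Cg * H₂ / 2 + κ * Cl * (1 + H₂) / 2) * S) with hc₁
  set c₂ : ℝ := δ * S * Cg with hc₂
  set b : ℝ → ℝ := fun t => (Ioc S (S + δ)).indicator (fun t => |∫ s in (t - S)..t, P s|) t +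
    (Ioi S).indicator (fun t => ((∫ s in (t - S)..(t - S + δ), F s) + ∫ s in (t - δ)..t, F s) +
      δ * (∫ s in (t - S)..t, K s) + c₁ + c₂ * ∫ s in (t - S)..t, Eu s) t with hb
  -- nonnegativity
  have he0 : ∀ s, 0 ≤ e s := fun s => integral_nonneg fun _ => sq_nonneg _
  have hq0 : ∀ s, 0 ≤ q s := fun s => mul_nonneg hκ.le ENNReal.toReal_nonneg
  have hEu0 : ∀ s, 0 ≤ Eu s := fun s => integral_nonneg fun _ => sq_nonneg _
  have hc0 : ∀ n, 0 ≤ c n := fun n => ENNReal.toReal_nonneg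
  have hcC : ∀ n, c n ≤ H₂ / 2 := fun n => by
    have h1 := ((hrel n).toReal_eScalarDissipation_le_half hκ (hh.memLp 2)
      (lintegral_rpow_half_translate_lt_top hG (by positivity) (by linarith : (0 : ℝ) < S + 1)) (by linarith : S ≤ S + 1)).2
    simp only [hc]; linarith
  have hsqC : ∀ n, |Real.sqrt (c n)| ≤ Real.sqrt (H₂ / 2) := fun n => by
    rw [abs_of_nonneg (Real.sqrt_nonneg _)]; exact Real.sqrt_le_sqrt (hcC n)
  have hw0 : ∀ s, 0 ≤ w s := fun s => AgeDecoupling.gridFun_nonneg (c := fun n => Real.sqrt (c n)) (fun n => Real.sqrt_nonneg _) s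
  have hw2 : (fun s => w s ^ 2) = fun s => if 0 < s then c (⌈s / δ⌉₊ - 1) else 0 := by
    funext s; simp only [hw]; split_ifs
    · exact Real.sq_sqrt (hc0 _)
    · simp
  have hF0 : ∀ s, 0 ≤ F s := fun s => div_nonneg (add_nonneg zero_le_one (mul_nonneg hH20 (he0 s))) zero_le_two
  have hK0 : ∀ s, 0 ≤ K s := fun s => by
    have h3 : 0 ≤ κ * Cl := mul_nonneg hκ.le hCl0
    exact add_nonneg (add_nonneg (div_nonneg (mul_nonneg hCg0 (add_nonneg (he0 s) (hEu0 s))) zero_le_two)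
      (div_nonneg (mul_nonneg h3 (by linarith [he0 s])) zero_le_two)) hH20
  have hK₁0 : 0 ≤ Cg * H₂ / 2 + κ * Cl * (1 + H₂) / 2 :=
    add_nonneg (div_nonneg (mul_nonneg hCg0 hH20) zero_le_two) (div_nonneg (mul_nonneg (mul_nonneg hκ.le hCl0) (by linarith)) zero_le_two)
  have hc₁0 : 0 ≤ c₁ := by have := hδ.le; have := hS.le; positivity
  have hc₂0 : 0 ≤ c₂ := by have := hδ.le; have := hS.le; positivity
  -- local integrability
  have hPi : ∀ T, IntegrableOn P (Ioc 0 T) := fun T => ((continuousOn_trace hθ hh T).integrableOn_Icc).mono_set Ioc_subset_Icc_self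
  have hei : ∀ T, IntegrableOn e (Ioc 0 T) := fun T => by
    rcases le_or_gt T 0 with hT | hT
    · rw [Ioc_eq_empty (not_lt.2 hT)]; exact integrableOn_empty
    · exact (integrableOn_scalarL2Sq hθ hT).1
  have hqi : ∀ T, IntegrableOn q (Ioc 0 T) := fun T => by
    rcases le_or_gt T 0 with hT | hT
    · rw [Ioc_eq_empty (not_lt.2 hT)]; exact integrableOn_empty
    · exact (integrableOn_dissipationRate hκ hθ hθ₀ hh hG hT).1
  have hEui : ∀ T, IntegrableOn Eu (Ioc 0 T) := fun T => by
    rcases le_or_gt T 0 with hT | hT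
    · rw [Ioc_eq_empty (not_lt.2 hT)]; exact integrableOn_empty
    · exact hEu T hT
  have h1i : ∀ T, IntegrableOn (fun _ : ℝ => (1 : ℝ)) (Ioc 0 T) := fun T => integrableOn_const measure_Ioc_lt_top.ne
  have hFi : ∀ T, IntegrableOn F (Ioc 0 T) := fun T => ((h1i T).add ((hei T).const_mul H₂)).div_const 2
  have hKi : ∀ T, IntegrableOn K (Ioc 0 T) := fun T =>
    (((((hei T).add (hEui T)).const_mul Cg).div_const 2).add ((((h1i T).add (hei T)).const_mul (κ * Cl)).div_const 2)).add
      (integrableOn_const measure_Ioc_lt_top.ne)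
  have hwi : ∀ T, IntegrableOn w (Ioc 0 T) := fun T => by
    rcases le_or_gt T 0 with hT | hT
    · rw [Ioc_eq_empty (not_lt.2 hT)]; exact integrableOn_empty
    · exact (intervalIntegrable_iff_integrableOn_Ioc_of_le hT.le).1
        (AgeDecoupling.intervalIntegrable_gridFun (c := fun n => Real.sqrt (c n)) (δ := δ) (Real.sqrt_nonneg _) hsqC 0 T)
  have hcabs : ∀ n, |c n| ≤ H₂ / 2 := fun n => by rw [abs_of_nonneg (hc0 n)]; exact hcC n
  have hw2i : ∀ T, IntegrableOn (fun s => w s ^ 2) (Ioc 0 T) := fun T => by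
    rw [hw2]
    rcases le_or_gt T 0 with hT | hT
    · rw [Ioc_eq_empty (not_lt.2 hT)]; exact integrableOn_empty
    · exact (intervalIntegrable_iff_integrableOn_Ioc_of_le hT.le).1
        (AgeDecoupling.intervalIntegrable_gridFun (c := c) (δ := δ) (by linarith [hH20]) hcabs 0 T)
  -- the patch `|∫_{t-S}^t P|` is integrable on `(S, S+δ]`
  have hgi : IntegrableOn (fun t => |∫ s in (t - S)..t, P s|) (Ioc S (S + δ)) :=
    (((AgeDecoupling.continuousOn_window hPi hS.le (S + δ)).abs).integrableOn_Icc).mono_set Ioc_subset_Icc_self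
  have hbi : ∀ T, IntegrableOn b (Ioc 0 T) := fun T =>
    AgeDecoupling.integrableOn_patchedSlack hgi (fun T => AgeDecoupling.continuousOn_slack hFi hKi hEui hδ.le (by linarith) T) T
  have hb0 : ∀ t, 0 ≤ b t := AgeDecoupling.patchedSlack_nonneg (fun t => abs_nonneg _)
    (AgeDecoupling.slack_nonneg hF0 hK0 hEu0 hδ.le hS.le hc₁0 hc₂0)
  -- bounded running means
  have he_bdd : IsBoundedUnder (· ≤ ·) atTop (timeMean e) := isBoundedUnder_timeMean_scalarL2Sq hκ hθ hθ₀ hh hh0 hG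
  have hw_bdd : IsBoundedUnder (· ≤ ·) atTop (timeMean fun s => w s ^ 2) := by
    rw [hw2]; exact AgeDecoupling.isBoundedUnder_timeMean_gridFun hc0 hcC
  -- eventual bounds on the running means of the budgets
  have hR0 : 0 ≤ R := (longTimeAvgSup_nonneg he0).trans hR
  have hE0' : 0 ≤ E := (longTimeAvgSup_nonneg hEu0).trans hE
  have hev_e : ∀ᶠ T in atTop, timeMean e T ≤ R + 1 :=
    (eventually_lt_of_limsup_lt (lt_of_le_of_lt hR (lt_add_one R)) he_bdd).mono fun T hT => hT.le
  have hev_E : ∀ᶠ T in atTop, timeMean Eu T ≤ E + 1 :=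
    (eventually_lt_of_limsup_lt (lt_of_le_of_lt hE (lt_add_one E)) hEb).mono fun T hT => hT.le
  have e1c : ∀ T : ℝ, 0 < T → timeMean (fun _ => (1 : ℝ)) T = 1 := fun T hT0 => by
    rw [timeMean, intervalIntegral.integral_const, smul_eq_mul, mul_one, sub_zero, inv_mul_cancel₀ hT0.ne']
  have hev_F : ∀ᶠ T in atTop, timeMean F T ≤ 1 / 2 + H₂ / 2 * (R + 1) := by
    filter_upwards [hev_e, eventually_gt_atTop (0 : ℝ)] with T hT hT0
    have eF : F = fun t => 1 / 2 * (1 : ℝ) + H₂ / 2 * e t := by funext s; simp only [hF]; ring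
    have e1 : timeMean F T = 1 / 2 * timeMean (fun _ => (1 : ℝ)) T + H₂ / 2 * timeMean e T := by
      rw [eF, timeMean_add hT0.le ((h1i T).const_mul _) ((hei T).const_mul _), timeMean_const_mul, timeMean_const_mul]
    rw [e1, e1c T hT0]
    nlinarith [mul_le_mul_of_nonneg_left hT (by positivity : 0 ≤ H₂ / 2)]
  have hev_K : ∀ᶠ T in atTop, timeMean K T ≤ (Cg / 2 + κ * Cl / 2) * (R + 1) + Cg / 2 * (E + 1) + (κ * Cl / 2 + H₂) := by
    filter_upwards [hev_e, hev_E, eventually_gt_atTop (0 : ℝ)] with T hT hT' hT0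
    have eK : K = fun t => ((Cg / 2 + κ * Cl / 2) * e t + Cg / 2 * Eu t) + (κ * Cl / 2 + H₂) * (1 : ℝ) := by
      funext s; simp only [hK]; ring
    have i1 : IntegrableOn (fun t => (Cg / 2 + κ * Cl / 2) * e t) (Ioc 0 T) := (hei T).const_mul _
    have i2 : IntegrableOn (fun t => Cg / 2 * Eu t) (Ioc 0 T) := (hEui T).const_mul _
    have i3 : IntegrableOn (fun _ => (κ * Cl / 2 + H₂) * (1 : ℝ)) (Ioc 0 T) := (h1i T).const_mul _
    have i12 : IntegrableOn (fun t => (Cg / 2 + κ * Cl / 2) * e t + Cg / 2 * Eu t) (Ioc 0 T) := i1.add i2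
    have e1 : timeMean K T = (Cg / 2 + κ * Cl / 2) * timeMean e T + Cg / 2 * timeMean Eu T +
        (κ * Cl / 2 + H₂) * timeMean (fun _ => (1 : ℝ)) T := by
      rw [eK, timeMean_add hT0.le i12 i3, timeMean_add hT0.le i1 i2, timeMean_const_mul, timeMean_const_mul,
        timeMean_const_mul]
    rw [e1, e1c T hT0]
    have h3 : 0 ≤ κ * Cl := mul_nonneg hκ.le hCl0
    nlinarith [mul_le_mul_of_nonneg_left hT (by positivity : 0 ≤ Cg / 2 + κ * Cl / 2),
      mul_le_mul_of_nonneg_left hT' (by positivity : 0 ≤ Cg / 2)]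
  have hb_ev := AgeDecoupling.eventually_timeMean_patchedSlack_le (c₁ := c₁) hFi hKi hEui hF0 hK0 hEu0 hδ (by linarith) hc₁0 hc₂0
    (fun t => abs_nonneg _) hgi hev_F hev_K hev_E
  have hb_bdd : IsBoundedUnder (· ≤ ·) atTop (timeMean b) := ⟨_, hb_ev⟩
  have hb_le : longTimeAvgSup b ≤ δ * (2 * (1 / 2 + H₂ / 2 * (R + 1)) +
      S * ((Cg / 2 + κ * Cl / 2) * (R + 1) + Cg / 2 * (E + 1) + (κ * Cl / 2 + H₂)) + 1) + c₁ + c₂ * (S * (E + 1)) :=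
    longTimeAvgSup_le_of_eventually_le hb0 hb_ev
  -- ### the age-decoupling inequality
  have hmain := AgeDecoupling.longTimeAvgSup_le_of_window (p := P) (e := e) (q := q) (w := w) (b := b)
    (C₀ := (1 / 2) * ∫ y, θ₀ y ^ 2) (c := H₂) hS hPi hei hqi hwi hw2i hbi he0 hq0 hw0 hb0 hH20
    (ae_trace_sq_le hθ hh)
    ((eventually_gt_atTop (0 : ℝ)).mono fun T hT => intervalIntegral_dissipationRate_le hκ hθ hθ₀ hh hG hT)
    (ae_window_ineq_patched hκ hCg hCl hδ hδS hW) he_bdd hw_bdd hb_bdd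
  -- ### the means of `w²`, `e`, `b`
  have hD : longTimeAvgSup (fun s => w s ^ 2) ≤
      limsup (fun N : ℕ => (N : ℝ)⁻¹ * ∑ n ∈ Finset.range N, c n) atTop := by
    rw [hw2]; exact AgeDecoupling.longTimeAvgSup_gridFun_le hδ hc0 hcC
  have hD0 : 0 ≤ longTimeAvgSup (fun s => w s ^ 2) := longTimeAvgSup_nonneg fun s => sq_nonneg _
  have hK : longTimeAvgSup b ≤ δ * ((2 + H₂ * (R + 1) + S * (Cg / 2 * (R + 1) + Cg / 2 * (E + 1) + H₂) +
      3 / 2 * S * H₂ + S ^ 2 * Cg * H₂ + S ^ 2 * Cg * (E + 1)) + κ₁ * (S * (Cl / 2 * (R + 1) + Cl / 2) + S ^ 2 * Cl * (1 + H₂))) := by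
    have hKb : 0 ≤ S * (Cl / 2 * (R + 1) + Cl / 2) + S ^ 2 * Cl * (1 + H₂) := by have := hS.le; positivity
    have h1 := mul_le_mul_of_nonneg_right hκ₁ (mul_nonneg hδ.le hKb)
    have e1 : δ * (2 * (1 / 2 + H₂ / 2 * (R + 1)) + S * ((Cg / 2 + κ * Cl / 2) * (R + 1) + Cg / 2 * (E + 1) + (κ * Cl / 2 + H₂)) + 1) +
        c₁ + c₂ * (S * (E + 1)) = δ * ((2 + H₂ * (R + 1) + S * (Cg / 2 * (R + 1) + Cg / 2 * (E + 1) + H₂) +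
        3 / 2 * S * H₂ + S ^ 2 * Cg * H₂ + S ^ 2 * Cg * (E + 1))) + κ * (δ * (S * (Cl / 2 * (R + 1) + Cl / 2) + S ^ 2 * Cl * (1 + H₂))) := by
      simp only [hc₁, hc₂]; ring
    rw [e1] at hb_le
    nlinarith [hb_le, h1]
  -- ### monotonicity of the bound
  refine hmain.trans (pow_le_pow_left₀ (by positivity) (add_le_add ?_ ?_) 2)
  · exact Real.sqrt_le_sqrt (mul_le_mul_of_nonneg_left hD hS.le)
  · refine Real.sqrt_le_sqrt (add_le_add (add_le_add ?_ ?_) ?_)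
    · exact div_le_div_of_nonneg_right hR (by positivity)
    · exact div_le_div_of_nonneg_right hK hS.le
    · exact mul_le_mul_of_nonneg_left hD (by positivity)

end Estimate

end Torus

end Literature.Analysis.FluidPDE
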